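import Summits.Ventures.HSemireg.Pad4FirstOrderModelRayRuleUpper

/-!
# Venture HSemireg — THEOREM L^ζ step S2c: TOP FLAGS (F1)(F2) in the first-order model (companion of
# `Pad4FirstOrderModel.lean`, row 716; TIER-2 step S2c over S2a `rayRule_lower` and S2b `rayRule_upper`)

HONEST FRAMING. PROVED statements about the first-order MODEL of the PAD-4 anchor (seat s4-prove-1 g24, TRACK S4-PUSH lane
(ii), 2026-08-27). `TheoremLZetaMain` ∕ `TheoremLZeta` (p505821) stay kernel-OPEN (`@[conjecture]`); nothing here proves them.
WHAT IS PROVED. `exists_topFlag` (F1): in ANY design `D` with sections `φ` satisfying `Minimal` and (E1) = `H2` (only the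
two ray rules at the Weil directions `E_{gg'}` are consumed) and with SOME constituent charged on `≥ 2` factors, there is a
TOP FLAG (`TopFlag D φ`): an axis `f`, a second factor `σ ≠ f` and an `N`-constituent `X = N i` charged EXACTLY on
`{σ, f}` whose f-charge `h` is maximal among the `≥ 2`-charged constituents of both levels, such that no `≥ 2`-charged `P`
reaches f-charge `h`, every σ-ray partner of `X` is a copy of `Q₀ = h ℓ_ζ^{(f)}` (uncharged on `σ`), and one copy of `Q₀`
joined to `X` by a non-zero section coordinate exists. MECHANISM (PAD4-THEOREM-L §1 (F1) ∕ §5 (P1)): `h := max` f-charge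
over the `≥ 2`-charged constituents for an axis `f` charged by the given constituent (`Finset.exists_max_image`); a
`≥ 2`-charged `P` at height `h` has, by the UPPER ray rule along `f` (S2b, second charged factor from `nCharged ≥ 2`), an
`N` above it with the same letters off `f` — again `≥ 2`-charged, f-charge `> h`: so the maximiser is an `N`; the LOWER
ray rule (S2a) at it along a charged `σ ≠ f` yields a partner with the same letters off `σ`, f-charge `h`, hence
single-charged (else a `≥ 2`-charged `P` at height `h`), so `supp X = {σ, f}` and the partner is a copy of `Q₀`.
`topFlag_F2` (F2): an `N`-constituent `N r` with an entry into a copy of `Q₀` is either an f-SERVER (f-charge `> h`,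
uncharged elsewhere — maximality of `h`) or a FLAG AT HEIGHT `h` (f-charge `h`, `X`'s f-phase, charged on exactly one
other factor `τ` — `= Q₀`'s class is excluded by `Minimal`, a third charged factor by the lower ray rule along `τ` and
(F1)); `topFlag_entry` records layer ∕ f-phase ∕ f-charge `≥ h` of any such `N r`. The server rows (R1) (S3) and THE END
are NOT in this file. No variety, sheaf or semiregularity map is constructed; nothing here says HC ∕ HC_CM ∕ HC_AV holds;
no fact, no instance, no notation; ONE definition (`structure TopFlag`, the package consumed by S3). REUSE: rows 716
(model), 731 (`idxH0_nonempty_iff`, `rel_eq_of_idx_zero_nonempty`, `layer_eq_of_idx_zero_nonempty`), S2a, S2b. Sizing: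
TIER2-SIZING-TheoremLZetaMain-prove-1-g23.md §5; typed targets TopFlagSig 10dfa31fc51bf5b5 (s4-prove-1 g23).
Typed ≠ proved ≠ endorsed.
-/

noncomputable section
namespace Summit.Ventures.HSemireg.Pad4FirstOrder
open Finset

/-! ## Bookkeeping: `rel = zero`, `nCharged`, list membership -/

/-- `rel Y X g = zero` (equal letters on `g`): same layer, equal charges, and `X` uncharged there or equal phases. -/
theorem of_rel_zero (Y X : Constituent) (g : Fin 4) (h : rel Y X g = Rel.zero) :
    Y.layer = X.layer ∧ Y.charge g = X.charge g ∧ (X.charge g = 0 ∨ Y.phase g = X.phase g) := by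
  have hn : (idx (rel Y X g) 0).Nonempty := by rw [h]; exact ⟨(0, 0), by simp [idx]⟩
  refine ⟨layer_eq_of_idx_zero_nonempty Y X g hn, ?_⟩
  rcases rel_eq_of_idx_zero_nonempty Y X g hn with ⟨-, hc, hp⟩ | ⟨hpos, -, -⟩
  · exact ⟨hc, hp⟩
  · rw [h] at hpos; cases hpos

/-- equal letters on `g` (same layer, equal charges, `X` uncharged or equal phases) give `rel Y X g = zero`. -/
theorem rel_zero_of_eq (Y X : Constituent) (g : Fin 4) (hl : Y.layer = X.layer) (hc : Y.charge g = X.charge g)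
    (hp : X.charge g = 0 ∨ Y.phase g = X.phase g) : rel Y X g = Rel.zero := by
  unfold rel
  rw [if_neg (not_not.mpr hl)]
  by_cases hX : X.charge g = 0
  · rw [if_pos ⟨by omega, hX⟩]
  · rw [if_neg (by omega), if_neg hX, if_neg (by omega), if_neg (not_not.mpr (hp.resolve_left hX)),
      if_neg (by omega), if_neg (by omega)]

/-- a constituent charged on two distinct factors is `≥ 2`-charged. -/
theorem two_le_nCharged (X : Constituent) (σ f : Fin 4) (hσf : σ ≠ f) (hσ : X.charge σ ≠ 0)
    (hf : X.charge f ≠ 0) : 2 ≤ X.nCharged := by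
  unfold Constituent.nCharged
  exact Finset.one_lt_card.mpr ⟨σ, by simp [hσ], f, by simp [hf], hσf⟩

/-- a `≥ 2`-charged constituent has, for every factor `f`, a charged factor other than `f`. -/
theorem exists_charged_ne_of_two_le (X : Constituent) (h : 2 ≤ X.nCharged) (f : Fin 4) :
    ∃ σ, σ ≠ f ∧ X.charge σ ≠ 0 := by
  unfold Constituent.nCharged at h
  obtain ⟨a, ha, b, hb, hab⟩ := Finset.one_lt_card.mp h
  rw [mem_filter] at ha hb
  by_cases haf : a = f
  · exact ⟨b, fun e => hab (haf.trans e.symm), hb.2⟩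
  · exact ⟨a, haf, ha.2⟩

/-- a `≥ 2`-charged constituent is charged somewhere. -/
theorem exists_charged_of_two_le (X : Constituent) (h : 2 ≤ X.nCharged) : ∃ f, X.charge f ≠ 0 :=
  (exists_charged_ne_of_two_le X h 0).imp fun _ h => h.2

/-- `N i` is one of the constituents of the design. -/
theorem Design.N_mem (D : Design) (i : Fin D.nN) : D.N i ∈ D.lower ++ D.upper :=
  List.mem_append_left _ (List.get_mem _ _)

/-- `P j` is one of the constituents of the design. -/
theorem Design.P_mem (D : Design) (j : Fin D.nP) : D.P j ∈ D.lower ++ D.upper :=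
  List.mem_append_right _ (List.get_mem _ _)

/-! ## The upper ray rule along an axis: above every `≥ 2`-charged `P` sits a `≥ 2`-charged `N` -/

/-- (F1), first sentence, engine: if `P j` is `≥ 2`-charged and charged on `f`, the UPPER ray rule along `f` (at the Weil
direction `E_{σ' f}` for a second charged factor `σ'`) gives an `N i` with the same letters off `f` and a larger
f-charge — again `≥ 2`-charged. -/
theorem exists_N_above_of_P (D : Design) (φ : D.Sections) (hmin : D.Minimal φ) (h2 : D.H2 φ) (j : Fin D.nP)
    (f : Fin 4) (hf : (D.P j).charge f ≠ 0) (h2c : 2 ≤ (D.P j).nCharged) :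
    ∃ i : Fin D.nN, 2 ≤ (D.N i).nCharged ∧ (D.P j).charge f < (D.N i).charge f := by
  obtain ⟨σ', hσ'f, hσ'⟩ := exists_charged_ne_of_two_le _ h2c f
  obtain ⟨i, -, hoff, hlt, -, -⟩ := rayRule_upper D φ hmin j f σ' (Ne.symm hσ'f) hf hσ' ((h2 _).2 j)
  have hσ'N : (D.N i).charge σ' = (D.P j).charge σ' := (of_rel_zero _ _ σ' (hoff σ' hσ'f)).2.1
  exact ⟨i, two_le_nCharged _ σ' f hσ'f (by rw [hσ'N]; exact hσ') (by omega), hlt⟩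

/-! ## The package -/

/-- **S2c package: a TOP FLAG of a design** — an `N`-constituent `X = N i` charged exactly on `{σ, f}` whose f-charge `h`
is maximal among the `≥ 2`-charged constituents of both levels, together with (F1): no `≥ 2`-charged `P` reaches f-charge
`h`, the σ-ray partners of `X` are copies of `Q₀ = h ℓ_ζ^{(f)}` (uncharged on `σ`), and one copy of `Q₀` with an entry
exists (PAD4-THEOREM-L §1 (F1) ∕ §5 (P1)). [definition of this file; the data consumed by the server rows (R1), S3] -/
structure TopFlag (D : Design) (φ : D.Sections) where
  /-- the axis `f`. -/
  f : Fin 4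
  /-- the flag's second factor `σ`. -/
  σ : Fin 4
  /-- `σ ≠ f`. -/
  hσf : σ ≠ f
  /-- the index of the flag `X = N i`. -/
  i : Fin D.nN
  /-- `X` is charged on `σ`. -/
  flag_σ : (D.N i).charge σ ≠ 0
  /-- `X` is charged on `f` (its f-charge is `h`). -/
  flag_f : (D.N i).charge f ≠ 0
  /-- `X` is uncharged off `{σ, f}`. -/
  flag_supp : ∀ g, g ≠ σ → g ≠ f → (D.N i).charge g = 0
  /-- maximality of `h := (D.N i).charge f` among the `≥ 2`-charged constituents of both levels. -/
  hmax : ∀ Y ∈ D.lower ++ D.upper, 2 ≤ Y.nCharged → Y.charge f ≤ (D.N i).charge f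
  /-- (F1), first sentence: no `≥ 2`-charged `P` at f-charge `h` (all are strictly below). -/
  noP : ∀ j : Fin D.nP, 2 ≤ (D.P j).nCharged → (D.P j).charge f < (D.N i).charge f
  /-- (F1), second sentence: every σ-ray partner of `X` with an entry is a copy of `Q₀` (uncharged on `σ`). -/
  partner_isQ0 : ∀ j : Fin D.nP, (∀ g, g ≠ σ → rel (D.N i) (D.P j) g = Rel.zero) →
    (∃ a ∈ idxH0 (D.N i) (D.P j), φ i j a ≠ 0) → (D.P j).charge σ = 0
  /-- and at least one copy of `Q₀` joined to `X` by a non-zero section coordinate exists (S2a at `κ₀ = E_{fσ}`). -/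
  exists_Q0 : ∃ j : Fin D.nP, (D.P j).charge σ = 0 ∧ (∀ g, g ≠ σ → rel (D.N i) (D.P j) g = Rel.zero) ∧
    ∃ a ∈ idxH0 (D.N i) (D.P j), φ i j a ≠ 0

/-! ## (F1): a top flag exists -/

/-- **(F1).** Under `Minimal` and (E1) = `H2` (in fact only the ray rules at the directions `E_{gg'}`), a design with a
`≥ 2`-charged constituent has a top flag. -/
theorem exists_topFlag (D : Design) (φ : D.Sections) (hmin : D.Minimal φ) (h2 : D.H2 φ)
    (hX : ∃ X ∈ D.lower ++ D.upper, 2 ≤ X.nCharged) : Nonempty (TopFlag D φ) := by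
  classical
  obtain ⟨X, hXmem, hX2⟩ := hX
  obtain ⟨f, hXf⟩ := exists_charged_of_two_le X hX2
  -- the `≥ 2`-charged constituents of both levels and a maximiser of the f-charge among them
  set S := (D.lower ++ D.upper).toFinset.filter (fun Y => 2 ≤ Y.nCharged) with hS
  have memS : ∀ Y, Y ∈ S ↔ Y ∈ D.lower ++ D.upper ∧ 2 ≤ Y.nCharged := fun Y => by
    rw [hS, Finset.mem_filter, List.mem_toFinset]
  obtain ⟨Y, hYS, hYmax⟩ := S.exists_max_image (fun Y => Y.charge f) ⟨X, (memS X).2 ⟨hXmem, hX2⟩⟩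
  have hh : Y.charge f ≠ 0 := by
    have hle : X.charge f ≤ Y.charge f := hYmax X ((memS X).2 ⟨hXmem, hX2⟩)
    omega
  -- (F1), first sentence: every `≥ 2`-charged `P` is strictly below height `h`
  have noP : ∀ j : Fin D.nP, 2 ≤ (D.P j).nCharged → (D.P j).charge f < Y.charge f := by
    intro j hj
    have hle : (D.P j).charge f ≤ Y.charge f := hYmax _ ((memS _).2 ⟨D.P_mem j, hj⟩)
    by_contra hnlt
    obtain ⟨i, hi2, hlt⟩ := exists_N_above_of_P D φ hmin h2 j f (by omega) hj
    have hle' : (D.N i).charge f ≤ Y.charge f := hYmax _ ((memS _).2 ⟨D.N_mem i, hi2⟩)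
    omega
  -- so the maximiser is an `N`-constituent
  obtain ⟨hYmem, hY2⟩ := (memS Y).1 hYS
  obtain ⟨i, hi⟩ : ∃ i : Fin D.nN, D.N i = Y := by
    rcases List.mem_append.1 hYmem with h | h
    · obtain ⟨n, hn⟩ := List.mem_iff_get.1 h
      exact ⟨n, hn⟩
    · obtain ⟨j, hj⟩ := List.mem_iff_get.1 h
      have hPj : D.P j = Y := hj
      have := noP j (by rw [hPj]; exact hY2)
      rw [hPj] at this
      exact absurd this (lt_irrefl _)
  subst hi
  -- a second charged factor `σ ≠ f` of the maximiser and its lower ray rule at `E_{fσ}`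
  obtain ⟨σ, hσf, hσ⟩ := exists_charged_ne_of_two_le _ hY2 f
  obtain ⟨j, -, hoff, -, -, hent⟩ := rayRule_lower D φ hmin i σ f hσf hσ ((h2 _).1 i)
  -- the partner carries `h` on `f`, hence is single-charged: a copy of `Q₀`; so `supp X = {σ, f}`
  have hPf : (D.P j).charge f = (D.N i).charge f := (of_rel_zero _ _ f (hoff f (Ne.symm hσf))).2.1.symm
  have single : ∀ g, g ≠ f → (D.P j).charge g = 0 := by
    intro g hgf
    by_contra hg
    have := noP j (two_le_nCharged _ g f hgf hg (by rw [hPf]; exact hh))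
    omega
  refine ⟨{ f := f, σ := σ, hσf := hσf, i := i, flag_σ := hσ, flag_f := hh, noP := noP, flag_supp := ?_,
            hmax := ?_, partner_isQ0 := ?_, exists_Q0 := ⟨j, single σ hσf, hoff, hent⟩ }⟩
  · intro g hgσ hgf
    rw [(of_rel_zero _ _ g (hoff g hgσ)).2.1]
    exact single g hgf
  · intro Z hZ hZ2
    exact hYmax Z ((memS Z).2 ⟨hZ, hZ2⟩)
  · intro j' hoff' _
    by_contra hσ'
    have hPf' : (D.P j').charge f = (D.N i).charge f := (of_rel_zero _ _ f (hoff' f (Ne.symm hσf))).2.1.symm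
    have := noP j' (two_le_nCharged _ σ f hσf hσ' (by rw [hPf']; exact hh))
    omega

/-! ## (F2): who enters a copy of `Q₀` -/

/-- a copy of `Q₀` (a σ-partner of the flag uncharged on `σ`) read off the flag: the flag's layer, the letter
`h ℓ_ζ^{(f)}` on `f` (charge `h`, the flag's f-phase), uncharged elsewhere. -/
theorem topFlag_Q0 (D : Design) (φ : D.Sections) (T : TopFlag D φ) (j : Fin D.nP)
    (hQ : (D.P j).charge T.σ = 0 ∧ ∀ g, g ≠ T.σ → rel (D.N T.i) (D.P j) g = Rel.zero) :
    (D.P j).layer = (D.N T.i).layer ∧ (D.P j).charge T.f = (D.N T.i).charge T.f ∧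
      (D.P j).phase T.f = (D.N T.i).phase T.f ∧ ∀ g, g ≠ T.f → (D.P j).charge g = 0 := by
  obtain ⟨hl, hc, hp⟩ := of_rel_zero _ _ _ (hQ.2 T.f T.hσf.symm)
  refine ⟨hl.symm, hc.symm, (hp.resolve_left (by rw [← hc]; exact T.flag_f)).symm, fun g hg => ?_⟩
  by_cases hgσ : g = T.σ
  · rw [hgσ]; exact hQ.1
  · rw [← (of_rel_zero _ _ g (hQ.2 g hgσ)).2.1]; exact T.flag_supp g hgσ hg

/-- an `N`-constituent with an entry into a copy of `Q₀` lies in the flag's layer, carries the flag's f-phase and has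
f-charge `≥ h` ((P0) at the entry). -/
theorem topFlag_entry (D : Design) (φ : D.Sections) (T : TopFlag D φ) (j : Fin D.nP)
    (hQ : (D.P j).charge T.σ = 0 ∧ ∀ g, g ≠ T.σ → rel (D.N T.i) (D.P j) g = Rel.zero)
    (r : Fin D.nN) (hr : ∃ a ∈ idxH0 (D.N r) (D.P j), φ r j a ≠ 0) :
    (D.N r).layer = (D.N T.i).layer ∧ (D.N r).phase T.f = (D.N T.i).phase T.f ∧
      (D.N T.i).charge T.f ≤ (D.N r).charge T.f := by
  obtain ⟨a, ha, -⟩ := hr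
  obtain ⟨hQl, hQf, hQph, -⟩ := topFlag_Q0 D φ T j hQ
  obtain ⟨hl, hP0⟩ := (idxH0_nonempty_iff (D.N r) (D.P j)).1 ⟨a, ha⟩
  have hfr := (hP0 T.f).resolve_left (by rw [hQf]; exact T.flag_f)
  exact ⟨hl.trans hQl, hfr.1.trans hQph, hQf ▸ hfr.2⟩

/-- **(F2).** The `N`-constituents with an entry into a copy of `Q₀` are f-SERVERS (charged on `f` only, f-charge `> h`)
or FLAGS AT HEIGHT `h` (f-charge `h`, the flag's f-phase, charged on exactly one other factor `τ`, any phase there);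
`= Q₀`'s own class is excluded by `Minimal`, a third charged factor by the lower ray rule along `τ` and (F1). -/
theorem topFlag_F2 (D : Design) (φ : D.Sections) (hmin : D.Minimal φ) (h2 : D.H2 φ) (T : TopFlag D φ)
    (j : Fin D.nP) (hQ : (D.P j).charge T.σ = 0 ∧ ∀ g, g ≠ T.σ → rel (D.N T.i) (D.P j) g = Rel.zero)
    (r : Fin D.nN) (hr : ∃ a ∈ idxH0 (D.N r) (D.P j), φ r j a ≠ 0) :
    ((D.N r).charge T.f > (D.N T.i).charge T.f ∧ ∀ g, g ≠ T.f → (D.N r).charge g = 0) ∨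
    ((D.N r).charge T.f = (D.N T.i).charge T.f ∧ (D.N r).phase T.f = (D.N T.i).phase T.f ∧
      ∃ τ, τ ≠ T.f ∧ (D.N r).charge τ ≠ 0 ∧ ∀ g, g ≠ τ → g ≠ T.f → (D.N r).charge g = 0) := by
  obtain ⟨hlr, hphr, hge⟩ := topFlag_entry D φ T j hQ r hr
  obtain ⟨a, ha, hφ⟩ := hr
  obtain ⟨hQl, hQf, hQph, hQ0⟩ := topFlag_Q0 D φ T j hQ
  rcases Nat.lt_or_eq_of_le hge with hlt | heq
  · -- a server: strictly above `h` on `f`, hence uncharged elsewhere by the maximality of `h`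
    left
    refine ⟨hlt, fun g hg => ?_⟩
    by_contra hgc
    have := T.hmax (D.N r) (D.N_mem r) (two_le_nCharged _ g T.f hg hgc (by omega))
    omega
  · -- at height `h`: not of `Q₀`'s class (`Minimal`), so charged on some `τ ≠ f`; then a flag
    right
    refine ⟨heq.symm, hphr, ?_⟩
    have hτ : ∃ τ, τ ≠ T.f ∧ (D.N r).charge τ ≠ 0 := by
      by_contra hno
      push Not at hno
      refine hφ (hmin r j (fun g => ?_) a)
      by_cases hg : g = T.f
      · rw [hg]
        exact rel_zero_of_eq _ _ _ (hlr.trans hQl.symm) (by rw [hQf, heq]) (Or.inr (by rw [hphr, hQph]))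
      · exact rel_zero_of_eq _ _ _ (hlr.trans hQl.symm) (by rw [hno g hg, hQ0 g hg]) (Or.inl (hQ0 g hg))
    obtain ⟨τ, hτf, hτc⟩ := hτ
    refine ⟨τ, hτf, hτc, ?_⟩
    -- the lower ray rule at `N r` along `τ` (direction `E_{fτ}`): the partner has f-charge `h`, so it is single-charged
    obtain ⟨j', -, hoff', -, -, -⟩ := rayRule_lower D φ hmin r τ T.f hτf hτc ((h2 _).1 r)
    have hP'f : (D.P j').charge T.f = (D.N r).charge T.f := (of_rel_zero _ _ _ (hoff' T.f hτf.symm)).2.1.symm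
    have single : ∀ g, g ≠ T.f → (D.P j').charge g = 0 := by
      intro g hgf
      by_contra hg
      have := T.noP j' (two_le_nCharged _ g T.f hgf hg (by rw [hP'f, ← heq]; exact T.flag_f))
      omega
    intro g hgτ hgf
    rw [(of_rel_zero _ _ g (hoff' g hgτ)).2.1]
    exact single g hgf

end Summit.Ventures.HSemireg.Pad4FirstOrder
end
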